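import Summits.CriticalPhenomena.PercolationContinuityZ3.Theorems.QuantitativeBGN.Negative.ArmLowerBound
import Literature.Probability.Percolation.HalfSpaceFloorDilution
import Literature.Probability.Percolation.ProdBernoulliRusso
import Mathlib.MeasureTheory.Integral.IntervalIntegral.Basic
import HarnessLib

/-!
# `QuantitativeBGN` (stmt-CriticalPhenomena-0913), line `microscopic-floor-doubling-gain` — definitions

The objects the line `microscopic-floor-doubling-gain` of the crux
`Summit.CriticalPhenomena.PercolationContinuityZ3.Theses.PercLowPointHalfSpace.QuantitativeBGN` posits
(skeleton `Cruxes/QuantitativeBGN/Lines/microscopic-floor-doubling-gain.lean`, card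
`Cruxes/QuantitativeBGN/Lines/microscopic-floor-doubling-gain.md`), stated in the tree's vocabulary so
that the line's stub files under `Theorems/` can import them:

* `armFrom r h` — the half-space cluster of the point `h·e₀` (height `h` above the floor `{x₀ = 0}` of
  `H = {x₀ ≥ 0}`) reaches sup-distance `≥ r` from its start, read on the lattice part `ω ∩ E(ℤ³)`;
* `gammaR r h = P_{p_c(ℤ³)}(armFrom r h)` — the depth-indexed boundary one-arm probability; `gammaR r 0`
  IS the probability bounded in the crux (`gammaR_zero_eq`, the registered readback this file lands under);
* the interpolating family in the floor density is the Literature's floor-diluted half-space measure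
  `floorDilutedPercolation 3 (criticalProbI 3) s` (`Literature/Probability/Percolation/HalfSpaceFloorDilution.lean`:
  floor edges at density `s · p_c`, the other half-space edges at `p_c`, edges leaving `H` closed), NOT
  re-declared here; `armProbFloor r j s` is `f_j(s) = P^{ℍ}_{p_c,s}(armFrom r j)`;
* `floorEdgesIn R` (the finite set of floor edges inside `Λ_R`),
  `pivotalFloorSum r j s = Σ_{e ∈ floorEdgesIn (r+j+1)} P^{ℍ}_{p_c,s}(e pivotal for armFrom r j)` (`g_j(s)`),
  and `floorLogGain r j = ∫₀¹ p_c · g_j(s)/f_j(s) ds` (`I_j`; by Russo's formula in the floor density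
  `f_j' = p_c g_j` on `(0,1)`, so `I_j = log f_j(1) − log f_j(0)` whenever `f_j(0) > 0`).

Plus the one-line facts every user needs (`0 ≤ γ ≤ 1`, `0 ≤ f ≤ 1`, `0 ≤ g`, the readbacks at `h = 0`).
Nothing here asserts anything about the crux; the statements of the line (depth monotonicity, the
`s = 0` comparison, the Russo inequality, the pivotal-floor density) are the registered stubs of the
skeleton and live in their own `Theorems/PercLowPointHalfSpaceQuantitativeBGNFloor*.lean` files.
-/

noncomputable section

open MeasureTheory Literature.Probability.Percolation Literature.Probability.LatticeModels
open scoped Classical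

namespace Summit.CriticalPhenomena.PercolationContinuityZ3.Theorems.FloorDoubling

/-! ## The depth-indexed arm event and its probability -/

/-- `armFrom r h`: the open cluster of the point `h·e₀ = Pi.single 0 h` computed inside the half-space
`H = {x | 0 ≤ x 0}` reaches sup-distance `≥ r` from its starting point, READ ON THE LATTICE PART
`ω ∩ E(ℤ³)` of the configuration (non-edges of `ℤ³` are a.s. closed under every measure of the line, so
this changes no probability — `gammaR_zero_eq` — but it makes the event literally increasing and literally
determined by the finitely many lattice edges within sup-distance `r` of the start). [folklore] -/
def armFrom (r h : ℕ) : Set (BondConfig (Site 3)) :=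
  {ω | ∃ y : Site 3, (∃ i : Fin 3, (r : ℤ) ≤ |y i - (Pi.single 0 (h : ℤ) : Site 3) i|) ∧
    ω ∩ (zdGraph 3).edgeSet ∈ openConnIn {x : Site 3 | 0 ≤ x 0} (Pi.single 0 (h : ℤ)) y}

/-- `γ_r(h) := P_{p_c(ℤ³)}(armFrom r h)`, the depth-indexed boundary one-arm probability at criticality.
[folklore] -/
def gammaR (r h : ℕ) : ℝ := (bondPercolation (zdGraph 3) (criticalProbI 3)).real (armFrom r h)

/-- Unfolding of `armFrom`. [folklore] -/
theorem mem_armFrom {r h : ℕ} {ω : BondConfig (Site 3)} :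
    ω ∈ armFrom r h ↔ ∃ y : Site 3, (∃ i : Fin 3, (r : ℤ) ≤ |y i - (Pi.single 0 (h : ℤ) : Site 3) i|) ∧
      ω ∩ (zdGraph 3).edgeSet ∈ openConnIn {x : Site 3 | 0 ≤ x 0} (Pi.single 0 (h : ℤ)) y :=
  Iff.rfl

/-- At depth `0` the event is the crux event read on the lattice part of `ω`. [folklore] -/
theorem armFrom_zero (r : ℕ) :
    armFrom r 0 = {ω | ∃ y : Site 3, (∃ i : Fin 3, (r : ℤ) ≤ |y i|) ∧
      ω ∩ (zdGraph 3).edgeSet ∈ openConnIn {x : Site 3 | 0 ≤ x 0} 0 y} := by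
  ext ω
  simp [armFrom]

/-- **Readback.** `γ_r(0)` IS the probability bounded in `QuantitativeBGN` (configurations are a.s.
supported on the lattice edges: `DCT16.real_congr_of_forall_subset_edgeSet`). [folklore] -/
theorem gammaR_zero_eq : ∀ r : ℕ, gammaR r 0 = (bondPercolation (zdGraph 3) (criticalProbI 3)).real {ω | ∃ y : Site 3, (∃ i : Fin 3, (r : ℤ) ≤ |y i|) ∧ ω ∈ openConnIn {x : Site 3 | 0 ≤ x 0} 0 y} := by
  intro r
  rw [gammaR, armFrom_zero]
  refine DCT16.real_congr_of_forall_subset_edgeSet (zdGraph 3) (criticalProbI 3) fun ω hω => ?_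
  simp only [Set.mem_setOf_eq, Set.inter_eq_left.2 hω]

/-- `γ_r(0)` is the disprover's `armH` probability (readback against the landed Negative lane
`Theorems/QuantitativeBGN/Negative/ArmLowerBound.lean`). [folklore] -/
theorem gammaR_zero_eq_armH (r : ℕ) :
    gammaR r 0 = (bondPercolation (zdGraph 3) (criticalProbI 3)).real
      (Theorems.QuantitativeBGN.Negative.armH r) := by
  rw [gammaR_zero_eq]; rfl

/-- `0 ≤ γ_r(h)`. [folklore] -/
theorem gammaR_nonneg (r h : ℕ) : 0 ≤ gammaR r h := measureReal_nonneg

/-- `γ_r(h) ≤ 1`. [folklore] -/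
theorem gammaR_le_one (r h : ℕ) : gammaR r h ≤ 1 := measureReal_le_one

/-! ## The interpolating family in the floor density (the Literature's floor-diluted measure) -/

/-- `f_j(s) := P^{ℍ}_{p_c,s}(armFrom r j)`: the probability of the depth-`j` arm event under the
floor-diluted half-space measure at `p = p_c(ℤ³)` and floor density `s · p_c`
(`floorDilutedPercolation`, Aizenman–Grimmett inhomogeneous densities restricted to the half-space).
[folklore] -/
def armProbFloor (r j : ℕ) (s : unitInterval) : ℝ :=
  (floorDilutedPercolation 3 (criticalProbI 3) s).real (armFrom r j)

/-- `0 ≤ f_j(s)`. [folklore] -/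
theorem armProbFloor_nonneg (r j : ℕ) (s : unitInterval) : 0 ≤ armProbFloor r j s := measureReal_nonneg

/-- `f_j(s) ≤ 1`. [folklore] -/
theorem armProbFloor_le_one (r j : ℕ) (s : unitInterval) : armProbFloor r j s ≤ 1 := measureReal_le_one

/-! ## Pivotal floor edges -/

/-- The floor edges (`floorEdgeSet 3`: lattice edges with both endpoints on `{x₀ = 0}`) with both
endpoints in the box `Λ_R = {-R,…,R}³` — a finite set; for `R ≥ r + j` it contains every floor edge
that can be pivotal for `armFrom r j`. [folklore] -/
def floorEdgesIn (R : ℕ) : Finset (Sym2 (Site 3)) :=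
  ((box 3 R).sym2).filter fun e => e ∈ floorEdgeSet 3

/-- Membership in `floorEdgesIn R`. [folklore] -/
theorem mem_floorEdgesIn {R : ℕ} {e : Sym2 (Site 3)} :
    e ∈ floorEdgesIn R ↔ (∀ x ∈ e, x ∈ box 3 R) ∧ e ∈ floorEdgeSet 3 := by
  simp [floorEdgesIn, Finset.mem_sym2_iff]

/-- `floorEdgesIn R ⊆ floorEdgeSet 3`. [folklore] -/
theorem floorEdgesIn_subset (R : ℕ) : ↑(floorEdgesIn R) ⊆ floorEdgeSet 3 :=
  fun _ he => (mem_floorEdgesIn.1 he).2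

/-- `g_j(s) := Σ_{e floor edge in Λ_{r+j+1}} P^{ℍ}_{p_c,s}(e is pivotal for armFrom r j)`; by Russo's
formula in the floor density, `f_j'(s) = p_c · g_j(s)` on `(0,1)`, and
`s p_c · g_j(s) = E_s[# open pivotal floor edges]`. [folklore] -/
def pivotalFloorSum (r j : ℕ) (s : unitInterval) : ℝ :=
  ∑ e ∈ floorEdgesIn (r + j + 1),
    (floorDilutedPercolation 3 (criticalProbI 3) s).real {ω | IsPivotal (armFrom r j) e ω}

/-- `0 ≤ g_j(s)`. [folklore] -/
theorem pivotalFloorSum_nonneg (r j : ℕ) (s : unitInterval) : 0 ≤ pivotalFloorSum r j s :=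
  Finset.sum_nonneg fun _ _ => measureReal_nonneg

/-- `I_j := ∫₀¹ p_c · g_j(s)/f_j(s) ds` — the `s`-integrated conditional count of pivotal floor edges
(`= ∫ E_s[# open pivotal floor edges | armFrom r j] ds/s`); the real integration variable is clamped
to `[0,1]` by `Set.projIcc` (the identity on the range of integration). [folklore] -/
def floorLogGain (r j : ℕ) : ℝ :=
  ∫ s in (0 : ℝ)..1,
    (criticalProbI 3 : ℝ) * pivotalFloorSum r j (Set.projIcc (0 : ℝ) 1 zero_le_one s) /
      armProbFloor r j (Set.projIcc (0 : ℝ) 1 zero_le_one s)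

end Summit.CriticalPhenomena.PercolationContinuityZ3.Theorems.FloorDoubling

end
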